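import Summits.CriticalPhenomena.Ising3DConformalLimit.Theorems.HyperoctahedralRPExistsScaleCovariantLimitDecimationPathLipschitzGivesCrux
import Summits.CriticalPhenomena.Ising3DConformalLimit.Theorems.HyperoctahedralRPExistsScaleCovariantLimitDecimationTwoCouplingGKS
import Summits.CriticalPhenomena.Ising3DConformalLimit.Theorems.EnergyNotSigmaSquaredGapForcesFarMergingRootFiniteEnergy
import Literature.Probability.LatticeModels.ModifiedSimonInequality
import Literature.Probability.LatticeModels.CriticalTwoPointLower
import HarnessLib

/-!
# The pinned normalisation of `finZoom` is positive along the critical curve (junk audit of `PathLipschitz p`)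

Crux `ExistsScaleCovariantLimit` (stmt-CriticalPhenomena-1981), line `decimation-homotopy-rate` (lead c8), scaffolding of the research
stubs `PathLipschitz 2/3`. The finite-volume pinned sublattice zoom `finZoom p N K J n L z = ⟨σ₀σ_{pLe₀}⟩^{-n/2}_{Λ_N;K,J} · ⟨∏σ_{pLzᵢ}⟩`
(`Theorems/…DecimationDefs.lean`) uses the real power of the axis pair average; it would be JUNK (`0 ^ (-1/2) = 0`) wherever that
average vanished, and `PathLipschitz p` could then fail or hold for a reason unrelated to its content. This file shows it does not
happen ON THE CRITICAL CURVE: for every `K ∈ [0, β_c]`, `J = J_χ(K)`, and every volume `N ≥ pL`, the normalising pair average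
`⟨σ₀σ_{pLe₀}⟩_{Λ_N; K, J_χ(K)}` is STRICTLY positive (`boxAvg_normalisation_pos`, registered sub-goal). Two cases: `K > 0` — Griffiths'
comparison down to `J = 0` (the free n.n. box model at `K`, bridge B) and positivity of the free n.n. pair function along the axis chain
`0 ∼ e₀ ∼ ⋯ ∼ pL e₀` (`isingCorr_pos_of_adj_chain`); `K = 0` — then `J_χ(0) = β_c(3) > 0` (stub C, `criticalBeta_pos_holds`) and by the
endpoint identity (stub E) the pair average is the free n.n. pair function of `Λ_{⌊N/p⌋}` at `β_c` along `0 ∼ ⋯ ∼ L e₀`.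

Sources: S. Friedli, Y. Velenik, *Statistical Mechanics of Lattice Systems* (CUP 2017) §3.8.1 (positivity of `ν_{Λ;K}` correlations on
the support of the couplings), Thm. 3.20 (GKS), Thm. 3.25 (i) (`β_c > 0`).
-/

noncomputable section

open Filter Topology
open scoped BigOperators
open Literature.Probability.LatticeModels
open Classical

namespace Summit.CriticalPhenomena.Ising3DConformalLimit.Cruxes.ExistsScaleCovariantLimit.DecimationHomotopyRate

/-- The axis site `t e₀` lies in `Λ_N` for `t ≤ N`. [folklore] -/
theorem axisSite_mem_box {N t : ℕ} (ht : t ≤ N) : (Pi.single 0 (t : ℤ) : Site 3) ∈ box 3 N := by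
  rw [mem_box]
  intro i
  by_cases hi : i = 0
  · subst hi; simp only [Pi.single_eq_same]; omega
  · simp only [Pi.single_eq_of_ne hi]; omega

/-- **The free n.n. box pair function along the axis is positive**: `0 < ⟨σ₀σ_{me₀}⟩^∅_{Λ_N;β,0}` for `β > 0`, `m ≤ N`
(positivity on an adjacent chain, `isingCorr_pos_of_adj_chain`). [cite: FriedliVelenik2017, §3.8.1, p. 141] -/
theorem isingExpect_axisPair_pos {β : ℝ} (hβ : 0 < β) {N m : ℕ} (hm : m ≤ N) :
    0 < isingExpect (zdGraph 3) (box 3 N) β 0 .free (spinMonomial (axisPair m)) := by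
  -- consecutive axis sites are nearest neighbours (cf. `RayRenewalHalfSpace.zdGraph_adj_axisPoint_succ` in the percolation cone)
  have hadj : ∀ t : ℕ, (zdGraph 3).Adj (Pi.single 0 (t : ℤ) : Site 3) (Pi.single 0 ((t + 1 : ℕ) : ℤ)) := fun t => by
    rw [zdGraph_adj_iff]
    refine ⟨0, Or.inl ?_⟩
    rw [← Pi.single_add]
    push_cast
    rfl
  have h := EnergyNotSigmaSquaredGapForcesFarMerging.isingCorr_pos_of_adj_chain (zdGraph 3) (Λ := box 3 N) hβ
    (fun t => (Pi.single 0 (t : ℤ) : Site 3)) m (fun t ht => axisSite_mem_box (ht.trans hm)) fun t _ => hadj t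
  rw [isingCorr] at h
  rw [axisPair, curveEndpoints_spinMonomial_pair, spinPair_eq_spinProduct_symmDiff]
  simpa using h

/-- **`K > 0`: the normalising pair average is positive** — `0 < ⟨σ₀σ_{me₀}⟩_{Λ_N;K,J}` for `K > 0`, `J ≥ 0`, `m ≤ N`: compare down to
`J = 0` (Griffiths), where the model is the free n.n. box model at `K` (bridge B). [cite: FriedliVelenik2017, Exercise 3.31, p. 142] -/
theorem boxAvg_axisPair_pos (p : ℕ) {N m : ℕ} {K J : ℝ} (hK : 0 < K) (hJ : 0 ≤ J) (hm : m ≤ N) :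
    0 < boxAvg p N K J (axisPair m) := by
  have hmem : ∀ i, axisPair m i ∈ box 3 N := curveEndpoints_pair_mem_box (axisSite_mem_box hm)
  calc (0 : ℝ) < boxAvg p N K 0 (axisPair m) := by
        rw [boxAvg_zero_J, stub_boxBridge N K 2 (axisPair m) hmem]
        exact isingExpect_axisPair_pos hK hm
    _ ≤ boxAvg p N K J (axisPair m) := TwoCouplingGKS.boxAvg_mono_couplings p N hK.le le_rfl le_rfl hJ _

/-- **`K = 0`: the normalising pair average is positive** — `0 < ⟨σ₀σ_{pLe₀}⟩_{Λ_N;0,J}` for `J > 0`, `pL ≤ N`: by the endpoint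
identity (stub E) and the bridge (stub B) it is the free n.n. pair function of `Λ_{⌊N/p⌋}` at `J` along `0 ∼ ⋯ ∼ L e₀`.
[cite: FriedliVelenik2017, §3.8.1, p. 141] -/
theorem boxAvg_axisPair_pos_zero_K {p : ℕ} (hp : 2 ≤ p) {N L : ℕ} {J : ℝ} (hJ : 0 < J) (hL : p * L ≤ N) :
    0 < boxAvg p N 0 J (axisPair (p * L)) := by
  have hp0 : 0 < p := by omega
  have hLN : L ≤ N / p := (Nat.le_div_iff_mul_le hp0).2 (by rwa [mul_comm] at hL)
  have hmem : ∀ i, axisPair L i ∈ box 3 (N / p) := curveEndpoints_pair_mem_box (axisSite_mem_box hLN)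
  rw [← smul_axisPair p L, stub_endpointIdentity p hp N J 2 (axisPair L), stub_boxBridge (N / p) J 2 (axisPair L) hmem]
  exact isingExpect_axisPair_pos hJ hLN

/-- **THE PINNED NORMALISATION IS POSITIVE ALONG THE CRITICAL CURVE** (registered sub-goal; junk audit of `finZoom` in
`PathLipschitz p`): for `p ≥ 2`, `K ∈ [0, β_c(3)]` and every volume `N ≥ pL`, `0 < ⟨σ₀σ_{pLe₀}⟩_{Λ_N; K, J_χ(K)}`. Case `K > 0`:
`boxAvg_axisPair_pos` with `J_χ(K) ≥ 0`; case `K = 0`: `J_χ(0) = β_c(3) > 0` (stub C, `criticalBeta_pos_holds`) and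
`boxAvg_axisPair_pos_zero_K`. [cite: FriedliVelenik2017, Thm. 3.25 (i) and §3.8.1] -/
theorem boxAvg_normalisation_pos :
    ∀ p : ℕ, 2 ≤ p → ∀ K ∈ Set.Icc (0 : ℝ) (criticalBeta 3), ∀ L N : ℕ, p * L ≤ N →
      0 < boxAvg p N K (Jcrit p K) (axisPair (p * L)) := by
  intro p hp K hK L N hN
  rcases hK.1.eq_or_lt with h0 | hpos
  · subst h0
    rw [(curveEndpoints_holds hp).1]
    exact boxAvg_axisPair_pos_zero_K hp (criticalBeta_pos_holds (d := 3) (by norm_num)) hN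
  · exact boxAvg_axisPair_pos p hpos (Real.sInf_nonneg fun _ hJ => hJ.1) hN

/-- Hence `finZoom` is honest on the curve: its normalising factor is the genuine negative power of a positive number,
`(⟨σ₀σ_{pLe₀}⟩^{-1/2})^n > 0`. [folklore] -/
theorem finZoom_normalisation_pos {p : ℕ} (hp : 2 ≤ p) {K : ℝ} (hK : K ∈ Set.Icc (0 : ℝ) (criticalBeta 3))
    (n : ℕ) {L N : ℕ} (hN : p * L ≤ N) :
    0 < ((boxAvg p N K (Jcrit p K) (axisPair (p * L))) ^ (-(1 / 2 : ℝ))) ^ n :=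
  pow_pos (Real.rpow_pos_of_pos (boxAvg_normalisation_pos p hp K hK L N hN) _) n

end Summit.CriticalPhenomena.Ising3DConformalLimit.Cruxes.ExistsScaleCovariantLimit.DecimationHomotopyRate

end
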